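import Mathlib
import HarnessLib
import Summits.ValiantsHypothesis.ValiantsHypothesis.Theses.MonotoneRestoration
import Summits.ValiantsHypothesis.ValiantsHypothesis.Theorems.MonotoneRestorationQP.Negative.OrbitRestorationFalseOfPolylogWidthVP
import Literature.Computability.AlgebraicComplexity.PatternExpressions
import Literature.ModelTheory.FiniteModelTheory.CkEquiv

/-!
# Route MonotoneRestoration, aside R1 = `OrbitRestorationLinearVolumeQP` (stmt-ValiantsHypothesis-18294) —
# `¬ R1` MODULO a linear-volume polylog-width `VP` hom family (the item's refutation instrument, typed)

The registered line `birth` of R1 rests, after `stub_homPoly_close` and `stub_close_orbit` (K2/K3, landed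
`…LinearVolumeQPBirthStubs.lean`), on the single stub `stub_lvNarrowSpan` — Dwivedi–Pago–Seppelt's Outlook
question 3 at quasi-polynomial scale for linear-volume patterns.  The item's own `why_might_fail` and the
refuter's verdict name the kill shape: "a VP combination of poly(n) hom polynomials of O(n)-vertex patterns
(e.g. from 3-regular CFI/expander patterns of linear treewidth) whose values separate
`C^{(log n)^{ω(1)}}`-equivalent graphs".  This file types that shape as the construction
`LinearVolumePolylogWidthVP` (the R1-class member form of the route's construction `PolylogWidthVP` of
`Theorems/MonotoneRestorationQP/Negative/OrbitRestorationFalseOfPolylogWidthVP.lean`) and records, kernel-checked: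

* `OrbitRestorationLinearVolumeQP_false_of_LinearVolumePolylogWidthVP : LinearVolumePolylogWidthVP → ¬ R1`
  — by the tree's PROVED orbit-form Dawar–Wilsenach pipeline `not_qpOrbitSymmetric_of_polylogSeparating`
  (a polylog-separating complex family has no square-symmetric circuits of quasi-polynomial ORBIT size);
* `polylogWidthVP_of_linearVolumePolylogWidthVP : LinearVolumePolylogWidthVP → PolylogWidthVP` — the new
  construction sits ABOVE the route's (hom combinations are matrix-symmetric, `rename_perm_homPoly`), so
  "no example is known" transfers (Dawar–Wilsenach 2025 §8; Dwivedi–Pago–Seppelt 2026 Outlook Q3);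
* `linearVolumePolylogWidthVP_of_single` — the `m_n = 1` instance: ONE linear-volume pattern family whose
  homomorphism polynomials form a `VP` family and are polylog-separating already suffices (the "unproved
  half" of the refuter's CFI candidate is exactly `VP`-membership).

Everything here is proved; R1 stays open (this is `¬ R1` modulo the construction).  Honest framing: the
dichotomy for the last stub of line `birth` is now typed on both sides — prove `stub_lvNarrowSpan`, or build
`LinearVolumePolylogWidthVP`; VP ≠ VNP is not moved either way (R1 is outside the cone of `closes`).
-/

noncomputable section

-- `Summit.ValiantsHypothesis.ValiantsHypothesis.…` is the tree's single-conjunct layout (Sub = Summit).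
set_option linter.dupNamespace false

namespace Summit.ValiantsHypothesis.ValiantsHypothesis.Theorems

open Summit.ValiantsHypothesis.ValiantsHypothesis.Theses.MonotoneRestoration
open Literature.Computability.AlgebraicComplexity
open Literature.ModelTheory.FiniteModelTheory

/-- **`H` = LINEAR-VOLUME POLYLOG-WIDTH VP HOM FAMILY** — the construction a counting-width refutation of R1
needs: a `VP` family over `ℂ` which is, level by level, a combination of `≤ (n+2)^c` homomorphism polynomials of
bipartite multigraph patterns with `≤ c (n+1)` vertices (the hypothesis class of `OrbitRestorationLinearVolumeQP`,
verbatim) and which is POLYLOG-SEPARATING: for every level `c'` and beyond every order `N` there are `m ≥ N` and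
two `≡^{C^{(log₂ m + c')^{c'}}}`-equivalent graphs on `Fin m` whose `0/1` adjacency matrices get different values
of `f m`.  The natural candidates are the homomorphism polynomials of 2-subdivided bounded-degree expanders of
linear treewidth (CFI base graphs); their `VP`-membership is the unproved half.  No example is known.
[conjecture-grade construction: DwivediPagoSeppelt2026 Outlook Q3; DawarWilsenach2025 §8] -/
def LinearVolumePolylogWidthVP : Prop :=
  ∃ f : (n : ℕ) → MvPolynomial (Fin n × Fin n) ℂ,
    IsVPFamily f ∧
    (∃ (c : ℕ) (m : ℕ → ℕ) (a b : (n : ℕ) → Fin (m n) → ℕ)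
        (E : (n : ℕ) → (i : Fin (m n)) → Multiset (Fin (a n i) × Fin (b n i)))
        (α : (n : ℕ) → Fin (m n) → ℂ),
      (∀ n, m n ≤ (n + 2) ^ c) ∧ (∀ n i, a n i + b n i ≤ c * (n + 1)) ∧
        ∀ n, f n = ∑ i : Fin (m n), MvPolynomial.C (α n i) * homPoly (E n i) n ℂ) ∧
    ∀ c N : ℕ, ∃ m : ℕ, N ≤ m ∧ ∃ X Y : SimpleGraph (Fin m),
      CkEquiv ((Nat.log 2 m + c) ^ c) X Y ∧
        MvPolynomial.eval (Set.indicator {ij : Fin m × Fin m | X.Adj ij.1 ij.2} 1) (f m) ≠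
          MvPolynomial.eval (Set.indicator {ij : Fin m × Fin m | Y.Adj ij.1 ij.2} 1) (f m)

/-- **`LinearVolumePolylogWidthVP → ¬ R1`.**  A linear-volume polylog-width `VP` hom family refutes
`OrbitRestorationLinearVolumeQP`: R1 would give it square-symmetric circuits of orbit size
`2^{(log₂ n + c)^c}`, which the orbit-form Dawar–Wilsenach pipeline
(`not_qpOrbitSymmetric_of_polylogSeparating`) forbids for a polylog-separating family.
[cite: DawarWilsenach2025, Thm 5.1, §6, §7.1; AndersonDawar2016, Thm 6] -/
theorem OrbitRestorationLinearVolumeQP_false_of_LinearVolumePolylogWidthVP :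
    LinearVolumePolylogWidthVP → ¬ OrbitRestorationLinearVolumeQP := by
  rintro ⟨f, hVP, hLV, hsep⟩ hR1
  exact not_qpOrbitSymmetric_of_polylogSeparating f hsep (hR1 f hVP hLV)

/-- A level-by-level combination of homomorphism polynomials is matrix-symmetric (invariant under
independent row and column permutations), by `rename_perm_homPoly`. [cite: DwivediPagoSeppelt2026, §1] -/
theorem rename_perm_homCombination {n m : ℕ} (a b : Fin m → ℕ)
    (E : (i : Fin m) → Multiset (Fin (a i) × Fin (b i))) (α : Fin m → ℂ) (σ τ : Equiv.Perm (Fin n)) :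
    MvPolynomial.rename (fun p : Fin n × Fin n => (σ p.1, τ p.2))
        (∑ i : Fin m, MvPolynomial.C (α i) * homPoly (E i) n ℂ) =
      ∑ i : Fin m, MvPolynomial.C (α i) * homPoly (E i) n ℂ := by
  rw [map_sum]
  refine Finset.sum_congr rfl fun i _ => ?_
  rw [map_mul, MvPolynomial.rename_C, rename_perm_homPoly]

/-- **The new construction sits above the route's**: a linear-volume polylog-width `VP` hom family is in
particular a polylog-width matrix-symmetric `VP` family (`PolylogWidthVP`, the construction of
`…/Negative/OrbitRestorationFalseOfPolylogWidthVP.lean`), matrix symmetry being automatic for hom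
combinations.  So every obstruction to `PolylogWidthVP` recorded there applies here.
[cite: DwivediPagoSeppelt2026, §1] -/
theorem polylogWidthVP_of_linearVolumePolylogWidthVP :
    LinearVolumePolylogWidthVP → PolylogWidthVP := by
  rintro ⟨f, hVP, ⟨c, m, a, b, E, α, -, -, hf⟩, hsep⟩
  refine ⟨f, fun n σ τ => ?_, hVP, hsep⟩
  rw [hf n]
  exact rename_perm_homCombination (a n) (b n) (E n) (α n) σ τ

/-- **The `m_n = 1` instance.**  ONE pattern family `F_n = (Fin (a n) ⊔ Fin (b n), E n)` of linear volume
`a n + b n ≤ c (n+1)` whose homomorphism polynomials `hom_{F_n,n}` form a `VP` family and are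
polylog-separating is already a `LinearVolumePolylogWidthVP` witness (one pattern, coefficient `1`).  For the
refuter's candidates — 2-subdivided bounded-degree expanders, whose CFI pairs the hom counts separate at linear
counting width — the open half is exactly the `VP` hypothesis. [cite: DwivediPagoSeppelt2026, Outlook Q3] -/
theorem linearVolumePolylogWidthVP_of_single (a b : ℕ → ℕ) (E : (n : ℕ) → Multiset (Fin (a n) × Fin (b n)))
    (c : ℕ) (hvol : ∀ n, a n + b n ≤ c * (n + 1))
    (hVP : IsVPFamily fun n => homPoly (E n) n ℂ)
    (hsep : ∀ c' N : ℕ, ∃ m : ℕ, N ≤ m ∧ ∃ X Y : SimpleGraph (Fin m),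
      CkEquiv ((Nat.log 2 m + c') ^ c') X Y ∧
        MvPolynomial.eval (Set.indicator {ij : Fin m × Fin m | X.Adj ij.1 ij.2} 1) (homPoly (E m) m ℂ) ≠
          MvPolynomial.eval (Set.indicator {ij : Fin m × Fin m | Y.Adj ij.1 ij.2} 1)
            (homPoly (E m) m ℂ)) :
    LinearVolumePolylogWidthVP := by
  refine ⟨fun n => homPoly (E n) n ℂ, hVP,
    ⟨max c 1, fun _ => 1, fun n _ => a n, fun n _ => b n, fun n _ => E n, fun _ _ => 1, fun n => ?_,
      fun n _ => (hvol n).trans (Nat.mul_le_mul_right _ (le_max_left _ _)), fun n => ?_⟩, hsep⟩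
  · exact Nat.one_le_pow _ _ (by omega)
  · simp

/-- **Contrapositive bookkeeping**: R1 forbids the construction — if `OrbitRestorationLinearVolumeQP` holds
then no linear-volume hom combination in `VP` is polylog-separating (its values on `0/1` matrices have
counting width polylog), i.e. the answer to Dwivedi–Pago–Seppelt's Outlook Q3 at quasi-polynomial scale is
"no" throughout the linear-volume class. [cite: DwivediPagoSeppelt2026, Outlook Q3] -/
theorem not_linearVolumePolylogWidthVP_of_orbitRestorationLinearVolumeQP
    (h : OrbitRestorationLinearVolumeQP) : ¬ LinearVolumePolylogWidthVP :=
  fun hH => OrbitRestorationLinearVolumeQP_false_of_LinearVolumePolylogWidthVP hH h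

end Summit.ValiantsHypothesis.ValiantsHypothesis.Theorems

end
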